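import Mathlib.Topology.Algebra.ClopenNhdofOne
import Mathlib.Topology.Algebra.Group.ClosedSubgroup
import Mathlib.GroupTheory.Commensurable
import Mathlib.GroupTheory.Index

/-!
# Conjugate subgroups of a profinite group: equality of the two indices of `A ∩ gAg⁻¹`

Let `G` be a profinite group (a compact, totally disconnected topological group), `A ≤ G` a CLOSED
subgroup and `g ∈ G`; put `B := A ∩ gAg⁻¹`.  We prove the "profinite unimodularity" identity

  `[A : B] = [gAg⁻¹ : B]`   (`relIndex_inf_conj_smul_eq`, with the convention `∞ = 0` of `Subgroup.relIndex`),

unconditionally (no commensurability hypothesis), together with the lemmas it rests on and its standard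
corollaries:

* `conj_smul_eq_self_of_le` — a closed subgroup of a profinite group that is contained in one of its
  conjugates is equal to it (`C ≤ gCg⁻¹ ⇒ gCg⁻¹ = C`; count the images in the finite quotients `G/U`);
* `iInf_sup_openNormalSubgroup` — a closed subgroup is the intersection of the subgroups `C·U`, `U` open
  normal (a repackaging of Mathlib's `ProfiniteGrp.closedSubgroup_eq_sInf_open`);
* `exists_openNormalSubgroup_inf_le` — a closed subgroup of finite index in `A` contains `A ∩ U` for some
  open normal `U ⊴ G`;
* `mem_commensurator_iff_relIndex_ne_zero` — for closed `A`, `g` commensurates `A` as soon as `A ∩ gAg⁻¹`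
  has finite index in `A` ALONE (one-sided finiteness suffices);
* `conj_smul_inf_eq_self_of_unique_index` — if moreover `A` has only one closed subgroup of index
  `[A : B]` (e.g. `A` pro-cyclic: cusp-inertia subgroups `≅ Ẑ(1)`), then `g` NORMALISES `B`; i.e. the
  commensurator of such an `A` is the union of the normalisers of its open subgroups.

These are the group-theoretic reduction steps behind the commensurable-terminality statements for
edge / cusp-inertia subgroups in Mochizuki's anabelian geometry (S. Mochizuki, *Semi-graphs of
anabelioids*, Publ. RIMS 42 (2006), Remark 2.10.1 p. 32 "`C_{Π_𝒢}(Π_b) = Π_b`"; *Topics in absolute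
anabelian geometry I*, Lemma 4.5 (vi)).  Classical / folklore (cf. L. Ribes, P. Zalesskii, *Profinite
Groups*, 2nd ed., Springer 2010, §2.1); Mathlib-only; nothing here bears on [IUTchIII] Cor. 3.12.
-/

open scoped Pointwise

namespace Literature.GroupTheory

namespace ProfiniteConjugateIndex

variable {G : Type*} [Group G]

/-! ### Pure group theory: indices are invariant under conjugation -/

/-- The relative index is invariant under simultaneous conjugation: `[gKg⁻¹ : gHg⁻¹ ∩ gKg⁻¹] = [K : H ∩ K]`
(Mathlib's `Subgroup.quotConjEquiv`). [folklore] -/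
private theorem relIndex_conj_smul (g : ConjAct G) (H K : Subgroup G) :
    (g • H).relIndex (g • K) = H.relIndex K :=
  (Nat.card_congr (Subgroup.quotConjEquiv H K g)).symm

/-- The index is invariant under conjugation: `[G : gHg⁻¹] = [G : H]`. [folklore] -/
private theorem index_conj_smul (g : ConjAct G) (H : Subgroup G) : (g • H).index = H.index := by
  rw [Subgroup.pointwise_smul_def]
  exact Subgroup.index_map_of_bijective (MulAction.bijective g) H

/-- Conjugation fixes a normal subgroup (pointwise form for `ConjAct`). [folklore] -/
private theorem conj_smul_eq_of_normal (g : ConjAct G) (U : Subgroup G) [hU : U.Normal] : g • U = U :=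
  hU.conjAct g

/-- `g • (A ⊓ U) = g • A ⊓ U` for `U` normal. [folklore] -/
private theorem conj_smul_inf_normal (g : ConjAct G) (A U : Subgroup G) [U.Normal] :
    g • (A ⊓ U) = g • A ⊓ U := by
  rw [Subgroup.smul_inf, conj_smul_eq_of_normal g U]

/-- `g • (A ⊔ U) = g • A ⊔ U` for `U` normal. [folklore] -/
private theorem conj_smul_sup_normal (g : ConjAct G) (A U : Subgroup G) [U.Normal] :
    g • (A ⊔ U) = g • A ⊔ U := by
  rw [Subgroup.smul_sup, conj_smul_eq_of_normal g U]

/-- `g⁻¹ • (A ⊓ g • A) = g⁻¹ • A ⊓ A`: the intersection `A ∩ gAg⁻¹` conjugated back. [folklore] -/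
private theorem inv_conj_smul_inf (g : ConjAct G) (A : Subgroup G) :
    g⁻¹ • (A ⊓ g • A) = g⁻¹ • A ⊓ A := by
  rw [Subgroup.smul_inf, inv_smul_smul]

/-- Two nested subgroups with the same FINITE index are equal. [folklore] -/
private theorem eq_of_le_of_index_eq {H K : Subgroup G} (hle : H ≤ K) (hidx : H.index = K.index)
    (hfin : K.index ≠ 0) : H = K := by
  have hmul := Subgroup.relIndex_mul_index hle
  rw [hidx] at hmul
  have h1 : H.relIndex K = 1 := by
    have : H.relIndex K * K.index = 1 * K.index := by rw [hmul, one_mul]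
    exact Nat.eq_of_mul_eq_mul_right (Nat.pos_of_ne_zero hfin) this
  exact le_antisymm hle (Subgroup.relIndex_eq_one.mp h1)

/-- Cancellation of relative indices along `C ≤ B ≤ A`, `C ≤ B ≤ A'` with `[A : C] = [A' : C]` finite:
then `[A : B] = [A' : B]`. [folklore] -/
private theorem relIndex_eq_of_relIndex_eq_of_le {C B A A' : Subgroup G} (hCB : C ≤ B) (hBA : B ≤ A)
    (hBA' : B ≤ A') (h : C.relIndex A = C.relIndex A') (hfin : C.relIndex A ≠ 0) :
    B.relIndex A = B.relIndex A' := by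
  have h1 := Subgroup.relIndex_mul_relIndex C B A hCB hBA
  have h2 := Subgroup.relIndex_mul_relIndex C B A' hCB hBA'
  have hCB0 : C.relIndex B ≠ 0 := by
    intro h0
    rw [h0, zero_mul] at h1
    exact hfin h1.symm
  rw [h, ← h2] at h1
  -- h1 : C.relIndex B * B.relIndex A = C.relIndex B * B.relIndex A'
  exact Nat.eq_of_mul_eq_mul_left (Nat.pos_of_ne_zero hCB0) h1

/-! ### Profinite groups -/

section Profinite

variable [TopologicalSpace G] [IsTopologicalGroup G] [CompactSpace G] [TotallyDisconnectedSpace G]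

omit [CompactSpace G] [TotallyDisconnectedSpace G] in
/-- Conjugates of a closed subgroup are closed (conjugation is a homeomorphism). [folklore] -/
private theorem isClosed_conj_smul (A : Subgroup G) (hA : IsClosed (A : Set G)) (g : ConjAct G) :
    IsClosed ((g • A : Subgroup G) : Set G) := by
  have hset : ((g • A : Subgroup G) : Set G) =
      (fun x : G => (ConjAct.ofConjAct g)⁻¹ * x * (ConjAct.ofConjAct g)⁻¹⁻¹) ⁻¹' (A : Set G) := by
    ext x
    simp only [SetLike.mem_coe, Set.mem_preimage, Subgroup.mem_pointwise_smul_iff_inv_smul_mem,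
      ConjAct.smul_def, ConjAct.ofConjAct_inv]
  rw [hset]
  exact hA.preimage ((continuous_const.mul continuous_id).mul continuous_const)

omit [TotallyDisconnectedSpace G] in
/-- In a compact group an open normal subgroup has finite (nonzero) index. [cite: DixonEtAl1999, Proposition 1.2 (i)] -/
theorem index_openNormalSubgroup_ne_zero (U : OpenNormalSubgroup G) : (U : Subgroup G).index ≠ 0 := by
  haveI : Finite (G ⧸ (U : Subgroup G)) :=
    Subgroup.quotient_finite_of_isOpen (U : Subgroup G) U.toOpenSubgroup.isOpen
  exact Subgroup.index_ne_zero_of_finite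

omit [TotallyDisconnectedSpace G] in
/-- `[G : H ⊔ U] ≠ 0` for `U` open normal. [cite: DixonEtAl1999, Proposition 1.2 (i)] -/
theorem index_sup_openNormalSubgroup_ne_zero (H : Subgroup G) (U : OpenNormalSubgroup G) :
    (H ⊔ (U : Subgroup G)).index ≠ 0 := by
  intro h0
  have hdvd := Subgroup.index_dvd_of_le (le_sup_right : (U : Subgroup G) ≤ H ⊔ (U : Subgroup G))
  rw [h0, zero_dvd_iff] at hdvd
  exact index_openNormalSubgroup_ne_zero U hdvd

omit [TotallyDisconnectedSpace G] in
/-- `[A : A ⊓ U] ≠ 0` for `U` open normal. [cite: DixonEtAl1999, Proposition 1.2 (i)] -/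
theorem relIndex_inf_openNormalSubgroup_ne_zero (A : Subgroup G) (U : OpenNormalSubgroup G) :
    (A ⊓ (U : Subgroup G)).relIndex A ≠ 0 := by
  rw [Subgroup.inf_relIndex_left]
  intro h0
  exact index_openNormalSubgroup_ne_zero U (Subgroup.index_eq_zero_of_relIndex_eq_zero h0)

/-- A closed subgroup `C` of a profinite group is the intersection of the open subgroups `C ⊔ U = C·U`,
`U` running over the open normal subgroups (repackaging of Mathlib's
`ProfiniteGrp.closedSubgroup_eq_sInf_open`). [cite: DixonEtAl1999, Proposition 1.2 (iii)] -/
theorem iInf_sup_openNormalSubgroup (C : Subgroup G) (hC : IsClosed (C : Set G)) :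
    ⨅ U : OpenNormalSubgroup G, C ⊔ (U : Subgroup G) = C := by
  apply le_antisymm
  · have hC' := ProfiniteGrp.closedSubgroup_eq_sInf_open (⟨C, hC⟩ : ClosedSubgroup G)
    change C = _ at hC'
    conv_rhs => rw [hC']
    refine le_sInf ?_
    rintro N ⟨hNopen, hCN⟩
    obtain ⟨U, hU⟩ := ProfiniteGrp.exist_openNormalSubgroup_sub_open_nhds_of_one hNopen N.one_mem
    have hUN : (U : Subgroup G) ≤ N := fun x hx => hU hx
    exact (iInf_le _ U).trans (sup_le hCN hUN)
  · exact le_iInf fun U => le_sup_left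

/-- **A closed subgroup of a profinite group contained in a conjugate of itself equals that conjugate**:
`C ≤ gCg⁻¹ ⇒ gCg⁻¹ = C`.  (In every finite quotient `G/U` the images of `C` and `gCg⁻¹` have the same
cardinality; pass to the limit with `iInf_sup_openNormalSubgroup`.) [cite: HoshiMochizukiCbTpII2022, Lemma 3.9 (iv) (proof, last step)] -/
theorem conj_smul_eq_self_of_le (C : Subgroup G) (hC : IsClosed (C : Set G)) (g : ConjAct G)
    (h : C ≤ g • C) : g • C = C := by
  refine le_antisymm ?_ h
  have key : ∀ U : OpenNormalSubgroup G, C ⊔ (U : Subgroup G) = g • C ⊔ (U : Subgroup G) := by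
    intro U
    refine eq_of_le_of_index_eq (sup_le_sup_right h _) ?_ (index_sup_openNormalSubgroup_ne_zero _ U)
    rw [← conj_smul_sup_normal, index_conj_smul]
  calc g • C ≤ ⨅ U : OpenNormalSubgroup G, g • C ⊔ (U : Subgroup G) := le_iInf fun U => le_sup_left
    _ = ⨅ U : OpenNormalSubgroup G, C ⊔ (U : Subgroup G) := by simp_rw [key]
    _ = C := iInf_sup_openNormalSubgroup C hC

/-- Symmetric form: `gCg⁻¹ ≤ C ⇒ gCg⁻¹ = C` for closed `C`. [cite: HoshiMochizukiCbTpII2022, Lemma 3.9 (iv) (proof, last step)] -/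
theorem conj_smul_eq_self_of_ge (C : Subgroup G) (hC : IsClosed (C : Set G)) (g : ConjAct G)
    (h : g • C ≤ C) : g • C = C := by
  have h' : C ≤ g⁻¹ • C := by
    intro x hx
    rw [Subgroup.mem_inv_pointwise_smul_iff]
    exact h (Subgroup.smul_mem_pointwise_smul _ _ _ hx)
  have := conj_smul_eq_self_of_le C hC g⁻¹ h'
  -- `g⁻¹ • C = C`; apply `g •` to both sides
  calc g • C = g • (g⁻¹ • C) := by rw [this]
    _ = C := smul_inv_smul g C

/-- A closed subgroup `B ≤ A` of FINITE index in `A` contains `A ∩ U` for some open normal subgroup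
`U ⊴ G` (finite index + closed ⇒ open in `A`; open normal subgroups form a basis at `1`). [cite: DixonEtAl1999, Proposition 1.2 (i), (v)] -/
theorem exists_openNormalSubgroup_inf_le {A B : Subgroup G} (hB : IsClosed (B : Set G))
    (hidx : B.relIndex A ≠ 0) : ∃ U : OpenNormalSubgroup G, A ⊓ (U : Subgroup G) ≤ B := by
  -- `B ∩ A` is closed of finite index in the compact group `A`, hence open in `A`
  haveI : (B.subgroupOf A).FiniteIndex := ⟨hidx⟩
  have hcl : IsClosed ((B.subgroupOf A : Subgroup A) : Set A) := by
    have : ((B.subgroupOf A : Subgroup A) : Set A) = ((↑) : A → G) ⁻¹' (B : Set G) := rfl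
    rw [this]
    exact hB.preimage continuous_subtype_val
  have hop : IsOpen ((B.subgroupOf A : Subgroup A) : Set A) :=
    Subgroup.isOpen_of_isClosed_of_finiteIndex _ hcl
  obtain ⟨W, hWopen, hW⟩ := isOpen_induced_iff.mp hop
  have h1W : (1 : G) ∈ W := by
    have : (1 : A) ∈ ((↑) : A → G) ⁻¹' W := by rw [hW]; exact (B.subgroupOf A).one_mem
    exact this
  obtain ⟨U, hU⟩ := ProfiniteGrp.exist_openNormalSubgroup_sub_open_nhds_of_one hWopen h1W
  refine ⟨U, fun x hx => ?_⟩
  have hx' : (⟨x, hx.1⟩ : A) ∈ ((↑) : A → G) ⁻¹' W := hU hx.2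
  rw [hW] at hx'
  exact hx'

/-- One-sided form of the main identity: if `[A : A ∩ gAg⁻¹]` is finite then it equals
`[gAg⁻¹ : A ∩ gAg⁻¹]`. [cite: MochizukiSemiAnbd2006, Remark 2.10.1 p.32 (PRIMS 42 p.255)] -/
theorem relIndex_inf_conj_smul_eq_of_ne_zero (A : Subgroup G) (hA : IsClosed (A : Set G)) (g : ConjAct G)
    (h : (A ⊓ g • A).relIndex A ≠ 0) : (A ⊓ g • A).relIndex A = (A ⊓ g • A).relIndex (g • A) := by
  set B : Subgroup G := A ⊓ g • A with hBdef
  have hgA : IsClosed ((g • A : Subgroup G) : Set G) := isClosed_conj_smul A hA g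
  have hB : IsClosed (B : Set G) := by
    rw [hBdef, Subgroup.coe_inf]
    exact hA.inter hgA
  obtain ⟨U, hU⟩ := exists_openNormalSubgroup_inf_le hB h
  -- `C := A ⊓ U` satisfies `C ≤ g • C`, hence `g • C = C`
  set C : Subgroup G := A ⊓ (U : Subgroup G) with hCdef
  have hC : IsClosed (C : Set G) := by
    rw [hCdef, Subgroup.coe_inf]
    exact hA.inter U.toOpenSubgroup.isClosed
  have hCle : C ≤ g • C := by
    rw [hCdef, conj_smul_inf_normal]
    exact le_inf (hU.trans inf_le_right) inf_le_right
  have hgC : g • C = C := conj_smul_eq_self_of_le C hC g hCle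
  -- `C ≤ B ≤ A`, `C ≤ B ≤ g • A`, `[A : C] = [g • A : g • C] = [g • A : C]`
  have hCB : C ≤ B := hU
  have h1 : C.relIndex A = C.relIndex (g • A) := by
    conv_rhs => rw [← hgC]
    rw [relIndex_conj_smul]
  exact relIndex_eq_of_relIndex_eq_of_le hCB inf_le_left inf_le_right h1
    (relIndex_inf_openNormalSubgroup_ne_zero A U)

/-- **Profinite unimodularity.**  For a closed subgroup `A` of a profinite group and any `g`,
`[A : A ∩ gAg⁻¹] = [gAg⁻¹ : A ∩ gAg⁻¹]` (both sides `0` when infinite). [cite: MochizukiSemiAnbd2006, Remark 2.10.1 p.32 (PRIMS 42 p.255)] -/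
theorem relIndex_inf_conj_smul_eq (A : Subgroup G) (hA : IsClosed (A : Set G)) (g : ConjAct G) :
    (A ⊓ g • A).relIndex A = (A ⊓ g • A).relIndex (g • A) := by
  by_cases h : (A ⊓ g • A).relIndex A ≠ 0
  · exact relIndex_inf_conj_smul_eq_of_ne_zero A hA g h
  · rw [not_ne_iff] at h
    by_cases h' : (A ⊓ g • A).relIndex (g • A) ≠ 0
    · -- apply the one-sided form to `A' := g • A`, `g' := g⁻¹`
      have hgA : IsClosed ((g • A : Subgroup G) : Set G) := isClosed_conj_smul A hA g
      have hsymm := relIndex_inf_conj_smul_eq_of_ne_zero (g • A) hgA g⁻¹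
      rw [inv_smul_smul, inf_comm] at hsymm
      exact (hsymm h').symm
    · rw [not_ne_iff] at h'
      rw [h, h']

/-! ### Corollaries: commensurators and normalisers -/

/-- For a CLOSED subgroup `A` of a profinite group, `g` commensurates `A` as soon as `A ∩ gAg⁻¹` has
finite index in `A` alone: the other finiteness is automatic by `relIndex_inf_conj_smul_eq`.
(Mathlib's `commensurator` is stated with `ConjAct.toConjAct g • A`.) [cite: MochizukiSemiAnbd2006, Remark 2.10.1 p.32 (PRIMS 42 p.255)] -/
theorem mem_commensurator_iff_relIndex_ne_zero (A : Subgroup G) (hA : IsClosed (A : Set G)) (g : G) :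
    g ∈ Subgroup.Commensurable.commensurator A ↔ (A ⊓ ConjAct.toConjAct g • A).relIndex A ≠ 0 := by
  rw [Subgroup.Commensurable.commensurator_mem_iff, Subgroup.Commensurable]
  constructor
  · rintro ⟨h1, -⟩
    rwa [← Subgroup.inf_relIndex_right, inf_comm] at h1
  · intro h
    refine ⟨?_, ?_⟩
    · rwa [← Subgroup.inf_relIndex_right, inf_comm]
    · rw [← Subgroup.inf_relIndex_right, ← relIndex_inf_conj_smul_eq A hA]
      exact h

/-- `Commensurable (g • A) A` for closed `A` already follows from finiteness of `[A : A ∩ gAg⁻¹]`.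
[cite: MochizukiSemiAnbd2006, Remark 2.10.1 p.32 (PRIMS 42 p.255)] -/
theorem commensurable_conj_smul_of_relIndex_ne_zero (A : Subgroup G) (hA : IsClosed (A : Set G))
    (g : ConjAct G) (h : (A ⊓ g • A).relIndex A ≠ 0) : Subgroup.Commensurable (g • A) A := by
  refine ⟨?_, ?_⟩
  · rwa [← Subgroup.inf_relIndex_right, inf_comm]
  · rw [← Subgroup.inf_relIndex_right, ← relIndex_inf_conj_smul_eq A hA]
    exact h

/-- The two "halves" `g⁻¹(A ∩ gAg⁻¹)g = g⁻¹Ag ∩ A` and `A ∩ gAg⁻¹` have the SAME index in `A`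
(closed `A`). [cite: MochizukiSemiAnbd2006, Remark 2.10.1 p.32 (PRIMS 42 p.255)] -/
theorem relIndex_inv_conj_smul_inf_eq (A : Subgroup G) (hA : IsClosed (A : Set G)) (g : ConjAct G) :
    (g⁻¹ • (A ⊓ g • A)).relIndex A = (A ⊓ g • A).relIndex A := by
  have h1 := relIndex_conj_smul g⁻¹ (A ⊓ g • A) (g • A)
  rw [inv_smul_smul] at h1
  rw [h1, relIndex_inf_conj_smul_eq A hA g]

/-- **Commensurator ⊆ union of normalisers of open subgroups.**  Let `A` be closed, `g` with
`[A : A ∩ gAg⁻¹] ≠ 0`, and suppose `A` has only ONE closed subgroup of index `[A : A ∩ gAg⁻¹]`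
(hypothesis `huniq`; e.g. `A` pro-cyclic).  Then `g` normalises `B := A ∩ gAg⁻¹`: `gBg⁻¹ = B`.
(Both `B` and `g⁻¹Bg` are closed subgroups of `A` of that index, by `relIndex_inv_conj_smul_inf_eq`.)
This is the reduction of commensurable terminality of a cusp-inertia / edge group to the computation of
normalisers of its open subgroups ([SemiAnbd] Rmk 2.10.1, [AbsTopI] Lem 4.5 (vi)). [cite: MochizukiSemiAnbd2006, Remark 2.10.1 p.32 (PRIMS 42 p.255)] -/
theorem conj_smul_inf_eq_self_of_unique_index (A : Subgroup G) (hA : IsClosed (A : Set G))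
    (g : ConjAct G)
    (huniq : ∀ H : Subgroup G, H ≤ A → IsClosed (H : Set G) →
      H.relIndex A = (A ⊓ g • A).relIndex A → H = A ⊓ g • A) :
    g • (A ⊓ g • A) = A ⊓ g • A := by
  set B : Subgroup G := A ⊓ g • A with hBdef
  have hB : IsClosed (B : Set G) := by
    rw [hBdef, Subgroup.coe_inf]
    exact hA.inter (isClosed_conj_smul A hA g)
  -- `g⁻¹ • B` is a closed subgroup of `A` of the same index, hence `= B`
  have hle : g⁻¹ • B ≤ A := by
    rw [hBdef, inv_conj_smul_inf]
    exact inf_le_right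
  have hcl : IsClosed ((g⁻¹ • B : Subgroup G) : Set G) := isClosed_conj_smul B hB g⁻¹
  have hidx : (g⁻¹ • B).relIndex A = B.relIndex A := relIndex_inv_conj_smul_inf_eq A hA g
  have key : g⁻¹ • B = B := huniq _ hle hcl hidx
  calc g • B = g • (g⁻¹ • B) := by rw [key]
    _ = B := smul_inv_smul g B

/-! ### Versions for `g : G` acting through `MulAut.conj` -/

/-- `relIndex_inf_conj_smul_eq` for `MulAut.conj g • A`. [cite: MochizukiSemiAnbd2006, Remark 2.10.1 p.32 (PRIMS 42 p.255)] -/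
theorem relIndex_inf_mulAut_conj_smul_eq (A : Subgroup G) (hA : IsClosed (A : Set G)) (g : G) :
    (A ⊓ MulAut.conj g • A).relIndex A = (A ⊓ MulAut.conj g • A).relIndex (MulAut.conj g • A) :=
  relIndex_inf_conj_smul_eq A hA (ConjAct.toConjAct g)

/-- `conj_smul_eq_self_of_le` for `MulAut.conj g • C`: a closed subgroup of a profinite group contained
in `gCg⁻¹` equals `gCg⁻¹`. [cite: HoshiMochizukiCbTpII2022, Lemma 3.9 (iv) (proof, last step)] -/
theorem mulAut_conj_smul_eq_self_of_le (C : Subgroup G) (hC : IsClosed (C : Set G)) (g : G)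
    (h : C ≤ MulAut.conj g • C) : MulAut.conj g • C = C :=
  conj_smul_eq_self_of_le C hC (ConjAct.toConjAct g) h

/-- Elementwise form: if `g c g⁻¹ ∈ C` for every `c ∈ C` (`C` closed, `G` profinite), then conjugation
by `g` maps `C` ONTO `C`, i.e. `g ∈ N_G(C)`. [cite: HoshiMochizukiCbTpII2022, Lemma 3.9 (iv) (proof, last step)] -/
theorem mem_normalizer_of_conj_mem (C : Subgroup G) (hC : IsClosed (C : Set G)) (g : G)
    (h : ∀ c ∈ C, g * c * g⁻¹ ∈ C) : g ∈ Subgroup.normalizer (C : Set G) := by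
  have hle : MulAut.conj g • C ≤ C := by
    rintro _ ⟨c, hc, rfl⟩
    exact h c hc
  have heq : MulAut.conj g • C = C := conj_smul_eq_self_of_ge C hC (ConjAct.toConjAct g) hle
  rw [Subgroup.mem_normalizer_iff]
  intro x
  constructor
  · intro hx
    exact h x hx
  · intro hx
    have : g * x * g⁻¹ ∈ MulAut.conj g • C := heq.symm ▸ hx
    obtain ⟨c, hc, hcx⟩ := this
    have hcx' : g * c * g⁻¹ = g * x * g⁻¹ := by
      simpa [MulAut.smul_def, MulAut.conj_apply] using hcx
    have : c = x := by
      have h2 : g * c = g * x := mul_right_cancel hcx'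
      exact mul_left_cancel h2
    exact this ▸ hc

end Profinite

end ProfiniteConjugateIndex

end Literature.GroupTheory
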